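import Mathlib
import HarnessLib
import Summits.AtomisticToContinuum.FouriersLaw.Theses.JunctionLocality
import Summits.AtomisticToContinuum.FouriersLaw.Theorems.JunctionLocalitySuperadditiveResistanceKuboFrame
import Summits.AtomisticToContinuum.FouriersLaw.Theorems.JunctionLocalitySuperadditiveResistanceStubKuboFrameAux1
import Summits.AtomisticToContinuum.FouriersLaw.Theorems.JunctionLocalitySuperadditiveResistanceStubJunctionCurvaturePairings

/-!
# Junction curvature of the probed END fields, II: the Dirichlet budget of the Kubo frame
(stub `stub_junctionCurvature` of line `thermalise-then-cut-probe-insertion`, crux `JunctionLocality.SuperadditiveResistance`,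
stmt-AtomisticToContinuum-11748; helper file, `--supports`)

The stub asks `N`-uniformly for `‖S_K gb₁‖² ≤ C₃ (selfLeft g)²`, `‖S_K gb₄‖² ≤ C₃ (selfRight g)²` over all Kubo frames of
the γ-probed device; no engine for that exists (workers + refuter: it carries the macro-ergodic content "the oscillation
of `gb₁` under local changes at the pair is `O(L₁₁)`"). This part lands the FREE, exact, `N`-uniform FIRST-derivative
budget against which that second-derivative bet is measured:

* `forwardField_pairing_eq_dirichlet` — finite-volume fluctuation–dissipation for a classical device forward field of
  ANY terminal observable `p_s² − T`: the four terminal momentum derivatives are in `L²(μ_T)` and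
  `⟨gb, p_s² − T⟩_{μ_T} = γT (‖∂_{p_0} gb‖² + ‖∂_{p_{N+M−1}} gb‖² + ‖∂_{p_{N−1}} gb‖² + ‖∂_{p_N} gb‖²)`
  (the landed `Kubo.fluctuation_dissipation` + `Kubo.memLp_partialP`, `deviceWeight` sums rewritten to the four sites);
* `helper_curvatureDirichletBudget` (registered) — with the `selfLeft`/`selfRight` clauses of `KuboFrame`:
  `selfLeft g = γ − (γ³/T)·Σ_{four sites} ‖∂_p gb₁‖²`, `selfRight g = γ − (γ³/T)·Σ ‖∂_p gb₄‖²` (exact);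
* `junctionDirichlet_le_of_kuboFrame` — hence `selfLeft g ≤ γ`, `selfRight g ≤ γ`, and the JUNCTION DIRICHLET ENERGY of
  each END field is `N`-uniformly bounded: `T(‖∂_{p_{N−1}} gb₁‖² + ‖∂_{p_N} gb₁‖²) ≤ (T²/γ³)(γ − selfLeft g) ≤ T²/γ²`.
  This is `O(1)`, not `O(selfLeft²)`: the entropy production of `gb₁` is dominated by its own bath (site `0`), and the stub is
  exactly the statement that the pair's share — one derivative more, `‖S_K gb₁‖² ≥ T Σ_{pair}‖∂_p gb₁‖²` by the OU spectral
  gap — is `O(L₁₁²)`.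

No definitions; standard axioms; folklore (Eckmann–Pillet–Rey-Bellet 1999 §3 for the carré-du-champ mechanism).
-/

noncomputable section

open MeasureTheory Filter Topology ProbabilityTheory
open scoped ContDiff NNReal ENNReal
open Literature.MathematicalPhysics.KineticTheory.HeatConduction

namespace Summit.AtomisticToContinuum.FouriersLaw.Cruxes.SuperadditiveResistance.ThermaliseThenCutProbeInsertion

open Summit.AtomisticToContinuum.FouriersLaw.Theorems.SuperadditiveResistance
open Summit.AtomisticToContinuum.FouriersLaw.Theorems.SuperadditiveResistance.Kubo
  (fluctuation_dissipation memLp_partialP memLp_kinetic memLp_momentum gauss_ibp integrable_mul_mul_gibbsDensity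
    integrable_sq_mul_gibbsDensity integrable_mul_gibbsDensity_iff integral_sq_mul_gibbsDensity_eq)
open Summit.AtomisticToContinuum.FouriersLaw.Theorems.SuperadditiveResistance.DeviceLiouville
  (liouvilleOp bathOp deviceWeight deviceGenerator_eq kin_eq_sq partialP_sub differentiable_partialP_of_contDiff_two)

section DirichletBudget

variable {ω₂ lam β γ : ℝ} {N M : ℕ}

/-- A site-indicator weight evaluates a sum at that site. -/
theorem sum_indicator_val_mul {L s : ℕ} (hs : s < L) (F : Fin L → ℝ) :
    ∑ i : Fin L, (if i.val = s then (1 : ℝ) else 0) * F i = F ⟨s, hs⟩ := by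
  rw [Finset.sum_eq_single ⟨s, hs⟩]
  · simp
  · intro i _ hi
    have : i.val ≠ s := fun h => hi (Fin.ext h)
    simp [this]
  · simp

/-- The device's weighted site sum is the sum over its four thermostatted sites `0, N+M−1, N−1, N`. -/
theorem sum_deviceWeight_mul (hN : 1 ≤ N) (hM : 1 ≤ M) (F : Fin (N + M) → ℝ) :
    ∑ i, deviceWeight N M i * F i =
      F ⟨0, by omega⟩ + F ⟨N + M - 1, by omega⟩ + F ⟨N - 1, by omega⟩ + F ⟨N, by omega⟩ := by
  simp only [deviceWeight, OscillatorChain.bathWeight, add_mul, Finset.sum_add_distrib]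
  rw [sum_indicator_val_mul (s := 0) (by omega), sum_indicator_val_mul (s := N + M - 1) (by omega),
    sum_indicator_val_mul (s := N - 1) (by omega), sum_indicator_val_mul (s := N) (by omega)]
  ring

/-- A forward field of the device in PAIR form: `1·X_H gb + γ S_B gb = −(p_s² − T)`, `B = deviceWeight`. -/
theorem forwardField_pair {T : ℝ} {s : ℕ} {gb : PhaseSpace (N + M) → ℝ}
    (hpde : ∀ x, deviceGenerator (pinnedChain ω₂ lam β γ) N M (fun _ => T) gb x = -(kin (N + M) s x - T))
    (x : PhaseSpace (N + M)) :
    1 * liouvilleOp (pinnedChain ω₂ lam β γ) (N + M) gb x +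
      γ * bathOp (N + M) (deviceWeight N M) T gb x = -(kin (N + M) s x - T) := by
  have h1 := hpde x
  have e : deviceGenerator (pinnedChain ω₂ lam β γ) N M (fun _ => T) gb x =
      DeviceLiouville.deviceGenerator (pinnedChain ω₂ lam β γ) N M (fun _ => T) gb x := rfl
  rw [e, deviceGenerator_eq] at h1
  have : (pinnedChain ω₂ lam β γ).γ = γ := rfl
  rw [this] at h1
  rw [one_mul]
  exact h1

/-- **Fluctuation–dissipation for a device forward field (fixed `N`, `M`; exact).** For the pinned chain
(`ω₂, γ, T > 0`, `lam, β ≥ 0`, `N, M ≥ 1`) and a classical forward field `gb ∈ C² ∩ L²(μ_T)` of the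
terminal observable `p_s² − T` of the γ-probed device (`L_dev gb = −(p_s² − T)` pointwise), the four
terminal momentum derivatives are in `L²(μ_T)` (finite entropy production) and the return pairing is the
Dirichlet energy on the four thermostatted sites:
`⟨gb, p_s² − T⟩_{μ_T} = γT (‖∂_{p_0} gb‖² + ‖∂_{p_{N+M−1}} gb‖² + ‖∂_{p_{N−1}} gb‖² + ‖∂_{p_N} gb‖²)`. -/
theorem forwardField_pairing_eq_dirichlet (hω : 0 < ω₂) (hl : 0 ≤ lam) (hβ : 0 ≤ β) (hγ : 0 < γ)
    {T : ℝ} (hT : 0 < T) (hN : 1 ≤ N) (hM : 1 ≤ M) {s : ℕ} (hs : s < N + M)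
    {gb : PhaseSpace (N + M) → ℝ} (hC : ContDiff ℝ 2 gb)
    (hL2 : MemLp gb 2 ((pinnedChain ω₂ lam β γ).gibbsMeasure (N + M) T))
    (hpde : ∀ x, deviceGenerator (pinnedChain ω₂ lam β γ) N M (fun _ => T) gb x = -(kin (N + M) s x - T)) :
    MemLp (partialP ⟨0, by omega⟩ gb) 2 ((pinnedChain ω₂ lam β γ).gibbsMeasure (N + M) T) ∧
    MemLp (partialP ⟨N + M - 1, by omega⟩ gb) 2 ((pinnedChain ω₂ lam β γ).gibbsMeasure (N + M) T) ∧
    MemLp (partialP ⟨N - 1, by omega⟩ gb) 2 ((pinnedChain ω₂ lam β γ).gibbsMeasure (N + M) T) ∧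
    MemLp (partialP ⟨N, by omega⟩ gb) 2 ((pinnedChain ω₂ lam β γ).gibbsMeasure (N + M) T) ∧
    ∫ x, gb x * (kin (N + M) s x - T) ∂((pinnedChain ω₂ lam β γ).gibbsMeasure (N + M) T) =
      γ * T * ((∫ x, partialP ⟨0, by omega⟩ gb x ^ 2 ∂((pinnedChain ω₂ lam β γ).gibbsMeasure (N + M) T)) +
        (∫ x, partialP ⟨N + M - 1, by omega⟩ gb x ^ 2 ∂((pinnedChain ω₂ lam β γ).gibbsMeasure (N + M) T)) +
        (∫ x, partialP ⟨N - 1, by omega⟩ gb x ^ 2 ∂((pinnedChain ω₂ lam β γ).gibbsMeasure (N + M) T)) +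
        ∫ x, partialP ⟨N, by omega⟩ gb x ^ 2 ∂((pinnedChain ω₂ lam β γ).gibbsMeasure (N + M) T)) := by
  set P := pinnedChain ω₂ lam β γ with hP
  have hpair := forwardField_pair (ω₂ := ω₂) (lam := lam) (β := β) (γ := γ) hpde
  have hk := memLp_kin_sub_line hω hl hβ γ hs hT
  have hW0 : ∀ i, 0 ≤ deviceWeight N M i := deviceWeight_nonneg N M
  have hFD := fluctuation_dissipation hω hl hβ (N + M) hT (deviceWeight N M) hW0 1 hγ hC hL2 hk hpair
  have hD : ∀ i, 0 < deviceWeight N M i → MemLp (partialP i gb) 2 (P.gibbsMeasure (N + M) T) := fun i hi =>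
    memLp_partialP hω hl hβ γ (N + M) hT _ hW0 1 hγ hC hL2 hk hpair hi
  have hw : ∀ i : Fin (N + M), i.val = 0 ∨ i.val = N + M - 1 ∨ i.val = N - 1 ∨ i.val = N →
      0 < deviceWeight N M i := by
    intro i hi
    unfold deviceWeight OscillatorChain.bathWeight
    rcases hi with h | h | h | h <;> simp [h] <;> split_ifs <;> norm_num
  have hD0 := hD ⟨0, by omega⟩ (hw _ (Or.inl rfl))
  have hDL := hD ⟨N + M - 1, by omega⟩ (hw _ (Or.inr (Or.inl rfl)))
  have hDa := hD ⟨N - 1, by omega⟩ (hw _ (Or.inr (Or.inr (Or.inl rfl))))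
  have hDb := hD ⟨N, by omega⟩ (hw _ (Or.inr (Or.inr (Or.inr rfl))))
  refine ⟨hD0, hDL, hDa, hDb, ?_⟩
  rw [sum_deviceWeight_mul hN hM] at hFD
  simp only [P.integral_gibbsMeasure]
  rw [hFD]
  ring

/-- **DIRICHLET BUDGET OF THE KUBO FRAME (fixed `N`, `M`; exact; both ends).** Under
`KuboFrame P T N M g gb₁ gb₄` (`P = pinnedChain ω₂ lam β γ`, `ω₂, γ, T > 0`, `lam, β ≥ 0`, `N, M ≥ 1`) the
END-bath self-conductances ARE entropy productions of their forward fields: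
`selfLeft g = γ − (γ³/T)(‖∂_{p_0} gb₁‖² + ‖∂_{p_{N+M−1}} gb₁‖² + ‖∂_{p_{N−1}} gb₁‖² + ‖∂_{p_N} gb₁‖²)` and likewise
`selfRight g` with `gb₄` (norms in `L²(μ_T)`; the `selfLeft`/`selfRight` clauses of the frame combined with the
finite-volume fluctuation–dissipation identity `⟨gb, p_s² − T⟩ = γT Σ_B ‖∂_p gb‖²`). Consequences recorded below:
`selfLeft g ≤ γ`, and the `N`-UNIFORM junction Dirichlet bound `T(‖∂_{p_{N−1}} gb₁‖² + ‖∂_{p_N} gb₁‖²) ≤ (T²/γ³)(γ − selfLeft g) ≤ T²/γ²`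
— the free first-derivative budget at the probed pair, against which the stub's second-derivative quantity
`‖S_K gb₁‖² ≤ C₃ (selfLeft g)²` is to be measured. -/
theorem helper_curvatureDirichletBudget : ∀ (ω₂ lam β γ T : ℝ), 0 < ω₂ → 0 ≤ lam → 0 ≤ β → 0 < γ → 0 < T → ∀ (N M : ℕ) (hN : 1 ≤ N) (hM : 1 ≤ M) (g : Fin 4 → Fin 4 → ℝ) (gb₁ gb₄ : PhaseSpace (N + M) → ℝ), KuboFrame (pinnedChain ω₂ lam β γ) T N M g gb₁ gb₄ → (MemLp (partialP ⟨N - 1, by omega⟩ gb₁) 2 ((pinnedChain ω₂ lam β γ).gibbsMeasure (N + M) T) ∧ MemLp (partialP ⟨N, by omega⟩ gb₁) 2 ((pinnedChain ω₂ lam β γ).gibbsMeasure (N + M) T) ∧ selfLeft g = γ - γ ^ 3 / T * ((∫ x, partialP ⟨0, by omega⟩ gb₁ x ^ 2 ∂((pinnedChain ω₂ lam β γ).gibbsMeasure (N + M) T)) + (∫ x, partialP ⟨N + M - 1, by omega⟩ gb₁ x ^ 2 ∂((pinnedChain ω₂ lam β γ).gibbsMeasure (N + M) T)) + (∫ x,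 partialP ⟨N - 1, by omega⟩ gb₁ x ^ 2 ∂((pinnedChain ω₂ lam β γ).gibbsMeasure (N + M) T)) + ∫ x, partialP ⟨N, by omega⟩ gb₁ x ^ 2 ∂((pinnedChain ω₂ lam β γ).gibbsMeasure (N + M) T))) ∧ (MemLp (partialP ⟨N - 1, by omega⟩ gb₄) 2 ((pinnedChain ω₂ lam β γ).gibbsMeasure (N + M) T) ∧ MemLp (partialP ⟨N, by omega⟩ gb₄) 2 ((pinnedChain ω₂ lam β γ).gibbsMeasure (N + M) T) ∧ selfRight g = γ - γ ^ 3 / T * ((∫ x, partialP ⟨0, by omega⟩ gb₄ x ^ 2 ∂((pinnedChain ω₂ lam β γ).gibbsMeasure (N + M) T)) + (∫ x, partialP ⟨N + M - 1, by omega⟩ gb₄ x ^ 2 ∂((pinnedChain ω₂ lam β γ).gibbsMeasure (N + M) T)) + (∫ x, partialP ⟨N - 1, by omega⟩ gb₄ x ^ 2 ∂((pinnedChain ω₂ lam β γ).gibbsMeasure (N + M) T)) + ∫ x, partialP ⟨N, by omega⟩ gb₄ x ^ 2 ∂((pinnedChain ω₂ lam β γ).gibbsMeasure (N + M) T))) :=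 by
  intro ω₂ lam β γ T hω hl hβ hγ hT N M hN hM g gb₁ gb₄ hKF
  obtain ⟨-, -, hff1, hff4, -, hself1, -, hself4⟩ := hKF
  obtain ⟨h1C, h1L2, -, -, h1pde⟩ := hff1
  obtain ⟨h4C, h4L2, -, -, h4pde⟩ := hff4
  have hPγ : (pinnedChain ω₂ lam β γ).γ = γ := rfl
  obtain ⟨-, -, h1a, h1b, h1⟩ := forwardField_pairing_eq_dirichlet hω hl hβ hγ hT hN hM (by omega) h1C h1L2 h1pde
  obtain ⟨-, -, h4a, h4b, h4⟩ :=
    forwardField_pairing_eq_dirichlet hω hl hβ hγ hT hN hM (s := N + M - 1) (by omega) h4C h4L2 h4pde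
  refine ⟨⟨h1a, h1b, ?_⟩, ⟨h4a, h4b, ?_⟩⟩
  · rw [hself1, hPγ, h1]
    field_simp
  · rw [hself4, hPγ, h4]
    field_simp

/-- **Corollary: the self-conductances are at most `γ`, and the junction Dirichlet energy of each END field is
`N`-uniformly bounded**: `0 ≤ γ − selfLeft g`, `T(‖∂_{p_{N−1}} gb₁‖² + ‖∂_{p_N} gb₁‖²) ≤ (T²/γ³)(γ − selfLeft g) ≤ T²/γ²`
(and the mirror for `gb₄`, `selfRight g`). -/
theorem junctionDirichlet_le_of_kuboFrame {ω₂ lam β γ T : ℝ} (hω : 0 < ω₂) (hl : 0 ≤ lam) (hβ : 0 ≤ β)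
    (hγ : 0 < γ) (hT : 0 < T) {N M : ℕ} (hN : 1 ≤ N) (hM : 1 ≤ M) {g : Fin 4 → Fin 4 → ℝ}
    {gb₁ gb₄ : PhaseSpace (N + M) → ℝ} (hKF : KuboFrame (pinnedChain ω₂ lam β γ) T N M g gb₁ gb₄) :
    selfLeft g ≤ γ ∧ selfRight g ≤ γ ∧
    T * ((∫ x, partialP ⟨N - 1, by omega⟩ gb₁ x ^ 2 ∂((pinnedChain ω₂ lam β γ).gibbsMeasure (N + M) T)) +
        ∫ x, partialP ⟨N, by omega⟩ gb₁ x ^ 2 ∂((pinnedChain ω₂ lam β γ).gibbsMeasure (N + M) T)) ≤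
      T ^ 2 / γ ^ 3 * (γ - selfLeft g) ∧
    T * ((∫ x, partialP ⟨N - 1, by omega⟩ gb₄ x ^ 2 ∂((pinnedChain ω₂ lam β γ).gibbsMeasure (N + M) T)) +
        ∫ x, partialP ⟨N, by omega⟩ gb₄ x ^ 2 ∂((pinnedChain ω₂ lam β γ).gibbsMeasure (N + M) T)) ≤
      T ^ 2 / γ ^ 3 * (γ - selfRight g) ∧
    T ^ 2 / γ ^ 3 * (γ - selfLeft g) ≤ T ^ 2 / γ ^ 2 ∧ T ^ 2 / γ ^ 3 * (γ - selfRight g) ≤ T ^ 2 / γ ^ 2 := by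
  have hsym := hKF.1
  have hpsd := hKF.2.1
  obtain ⟨⟨-, -, h1⟩, ⟨-, -, h4⟩⟩ := helper_curvatureDirichletBudget ω₂ lam β γ T hω hl hβ hγ hT N M hN hM g gb₁ gb₄ hKF
  have ha0 : 0 ≤ selfLeft g := selfLeft_nonneg hsym hpsd
  have hb0 : 0 ≤ selfRight g := selfRight_nonneg hsym hpsd
  set μ := (pinnedChain ω₂ lam β γ).gibbsMeasure (N + M) T with hμ
  have i0 : 0 ≤ ∫ x, partialP ⟨0, by omega⟩ gb₁ x ^ 2 ∂μ := integral_nonneg fun _ => sq_nonneg _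
  have iL : 0 ≤ ∫ x, partialP ⟨N + M - 1, by omega⟩ gb₁ x ^ 2 ∂μ := integral_nonneg fun _ => sq_nonneg _
  have ia : 0 ≤ ∫ x, partialP ⟨N - 1, by omega⟩ gb₁ x ^ 2 ∂μ := integral_nonneg fun _ => sq_nonneg _
  have ib : 0 ≤ ∫ x, partialP ⟨N, by omega⟩ gb₁ x ^ 2 ∂μ := integral_nonneg fun _ => sq_nonneg _
  have j0 : 0 ≤ ∫ x, partialP ⟨0, by omega⟩ gb₄ x ^ 2 ∂μ := integral_nonneg fun _ => sq_nonneg _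
  have jL : 0 ≤ ∫ x, partialP ⟨N + M - 1, by omega⟩ gb₄ x ^ 2 ∂μ := integral_nonneg fun _ => sq_nonneg _
  have ja : 0 ≤ ∫ x, partialP ⟨N - 1, by omega⟩ gb₄ x ^ 2 ∂μ := integral_nonneg fun _ => sq_nonneg _
  have jb : 0 ≤ ∫ x, partialP ⟨N, by omega⟩ gb₄ x ^ 2 ∂μ := integral_nonneg fun _ => sq_nonneg _
  have hγ3 : 0 < γ ^ 3 := by positivity
  have hTγ : 0 < γ ^ 3 / T := by positivity
  refine ⟨?_, ?_, ?_, ?_, ?_, ?_⟩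
  · rw [h1]
    nlinarith [mul_nonneg hTγ.le (add_nonneg (add_nonneg (add_nonneg i0 iL) ia) ib)]
  · rw [h4]
    nlinarith [mul_nonneg hTγ.le (add_nonneg (add_nonneg (add_nonneg j0 jL) ja) jb)]
  · rw [h1]
    have e : T ^ 2 / γ ^ 3 * (γ - (γ - γ ^ 3 / T * ((∫ x, partialP ⟨0, by omega⟩ gb₁ x ^ 2 ∂μ) +
        (∫ x, partialP ⟨N + M - 1, by omega⟩ gb₁ x ^ 2 ∂μ) + (∫ x, partialP ⟨N - 1, by omega⟩ gb₁ x ^ 2 ∂μ) +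
        ∫ x, partialP ⟨N, by omega⟩ gb₁ x ^ 2 ∂μ))) =
        T * ((∫ x, partialP ⟨0, by omega⟩ gb₁ x ^ 2 ∂μ) +
        (∫ x, partialP ⟨N + M - 1, by omega⟩ gb₁ x ^ 2 ∂μ) + (∫ x, partialP ⟨N - 1, by omega⟩ gb₁ x ^ 2 ∂μ) +
        ∫ x, partialP ⟨N, by omega⟩ gb₁ x ^ 2 ∂μ) := by
      field_simp
      ring
    rw [e]
    nlinarith
  · rw [h4]
    have e : T ^ 2 / γ ^ 3 * (γ - (γ - γ ^ 3 / T * ((∫ x, partialP ⟨0, by omega⟩ gb₄ x ^ 2 ∂μ) +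
        (∫ x, partialP ⟨N + M - 1, by omega⟩ gb₄ x ^ 2 ∂μ) + (∫ x, partialP ⟨N - 1, by omega⟩ gb₄ x ^ 2 ∂μ) +
        ∫ x, partialP ⟨N, by omega⟩ gb₄ x ^ 2 ∂μ))) =
        T * ((∫ x, partialP ⟨0, by omega⟩ gb₄ x ^ 2 ∂μ) +
        (∫ x, partialP ⟨N + M - 1, by omega⟩ gb₄ x ^ 2 ∂μ) + (∫ x, partialP ⟨N - 1, by omega⟩ gb₄ x ^ 2 ∂μ) +
        ∫ x, partialP ⟨N, by omega⟩ gb₄ x ^ 2 ∂μ) := by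
      field_simp
      ring
    rw [e]
    nlinarith
  · have : T ^ 2 / γ ^ 3 * (γ - selfLeft g) = T ^ 2 / γ ^ 2 - T ^ 2 / γ ^ 3 * selfLeft g := by
      field_simp
    rw [this]
    nlinarith [mul_nonneg (by positivity : (0 : ℝ) ≤ T ^ 2 / γ ^ 3) ha0]
  · have : T ^ 2 / γ ^ 3 * (γ - selfRight g) = T ^ 2 / γ ^ 2 - T ^ 2 / γ ^ 3 * selfRight g := by
      field_simp
    rw [this]
    nlinarith [mul_nonneg (by positivity : (0 : ℝ) ≤ T ^ 2 / γ ^ 3) hb0]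

end DirichletBudget

end Summit.AtomisticToContinuum.FouriersLaw.Cruxes.SuperadditiveResistance.ThermaliseThenCutProbeInsertion

end
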